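import Literature.Geometry.DiscreteGeometry.GegenbauerFourPSD
import Mathlib.Analysis.InnerProductSpace.GramMatrix
import Mathlib.Analysis.Matrix.PosDef
import Mathlib.LinearAlgebra.Matrix.Determinant.Basic

/-!
# The Bachoc–Vallentin three-point inequality (abstract form) — part B

For a finite `π/3`-code `C ⊂ S³` (unit vectors with pairwise inner products `≤ 1/2`), a
"two-point" function `A` with `Σ_{x,y∈C} A(x·y) ≥ 0`, a symmetric "three-point" function `F` with
`Σ_{x,y,z∈C} F(x·y, x·z, y·z) ≥ 0`, and constants `b₁₁, b₁₂, b₂₂` with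
`b₁₁ + 2 b₁₂ λ + b₂₂ λ² ≥ 0` for all `λ`, the two polynomial constraints of Bachoc–Vallentin
(2008), Theorem 4.2,
* `A(s) + 3 F(s,s,1) ≤ -1 - 2 b₁₂ - b₂₂` for `s ∈ [-1, 1/2]`,
* `F(u,v,t) ≤ -b₂₂` for `u, v, t ∈ [-1, 1/2]` with `1 + 2uvt - u² - v² - t² ≥ 0`,
imply `|C| ≤ 1 + A(1) + b₁₁ + F(1,1,1)` (`card_le_of_threePoint`). The proof is the bookkeeping
of BV §4 (splitting the triple sum according to coincidences among `x, y, z`).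
Also: the triple sum over `C³`, its invariance under permuting the three inner products, and the
Gram-determinant constraint `1 + 2uvt - u² - v² - t² ≥ 0` for three unit vectors.

## References
* C. Bachoc, F. Vallentin, *New upper bounds for kissing numbers from semidefinite programming*,
  J. Amer. Math. Soc. 21 (2008), §4, Theorem 4.2. [`BachocVallentin2007`]
-/

noncomputable section

open scoped RealInnerProductSpace

namespace Literature.Geometry.DiscreteGeometry

/-- Local notation for `ℝ⁴ = EuclideanSpace ℝ (Fin 4)`. -/
local notation "E⁴" => EuclideanSpace ℝ (Fin 4)

/-! ### Pair and triple sums over a configuration -/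

/-- `Σ_{x,y ∈ C} A(x·y)`. [cite: BachocVallentin2007, §4] -/
def pairSum (C : Finset E⁴) (A : ℝ → ℝ) : ℝ := ∑ x ∈ C, ∑ y ∈ C, A (inner ℝ x y)

/-- `Σ_{x,y,z ∈ C} G(x·y, x·z, y·z)`. [cite: BachocVallentin2007, §4] -/
def tripleSum (C : Finset E⁴) (G : ℝ → ℝ → ℝ → ℝ) : ℝ :=
  ∑ x ∈ C, ∑ y ∈ C, ∑ z ∈ C, G (inner ℝ x y) (inner ℝ x z) (inner ℝ y z)

/-- Invariance of the triple sum under `(u,v,t) ↦ (v,u,t)`. [folklore] -/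
theorem tripleSum_perm12 (C : Finset E⁴) (G : ℝ → ℝ → ℝ → ℝ) :
    tripleSum C (fun u v t => G v u t) = tripleSum C G := by
  unfold tripleSum
  refine Finset.sum_congr rfl fun x _ => ?_
  rw [Finset.sum_comm]
  refine Finset.sum_congr rfl fun y _ => Finset.sum_congr rfl fun z _ => ?_
  rw [real_inner_comm y z]

/-- Invariance of the triple sum under `(u,v,t) ↦ (u,t,v)`. [folklore] -/
theorem tripleSum_perm23 (C : Finset E⁴) (G : ℝ → ℝ → ℝ → ℝ) :
    tripleSum C (fun u v t => G u t v) = tripleSum C G := by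
  unfold tripleSum
  rw [Finset.sum_comm]
  refine Finset.sum_congr rfl fun x _ => Finset.sum_congr rfl fun y _ =>
    Finset.sum_congr rfl fun z _ => ?_
  rw [real_inner_comm x y]

/-- Reindexing a triple sum: swap the first two bound variables. [folklore] -/
theorem sum3_swap12 (C : Finset E⁴) (g : E⁴ → E⁴ → E⁴ → ℝ) :
    (∑ x ∈ C, ∑ y ∈ C, ∑ z ∈ C, g x y z) = ∑ x ∈ C, ∑ y ∈ C, ∑ z ∈ C, g y x z := by
  rw [Finset.sum_comm]

/-- Reindexing a triple sum: swap the last two bound variables. [folklore] -/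
theorem sum3_swap23 (C : Finset E⁴) (g : E⁴ → E⁴ → E⁴ → ℝ) :
    (∑ x ∈ C, ∑ y ∈ C, ∑ z ∈ C, g x y z) = ∑ x ∈ C, ∑ y ∈ C, ∑ z ∈ C, g x z y := by
  refine Finset.sum_congr rfl fun x _ => ?_
  rw [Finset.sum_comm]

/-- Invariance of the triple sum under `(u,v,t) ↦ (t,v,u)`. [folklore] -/
theorem tripleSum_perm13 (C : Finset E⁴) (G : ℝ → ℝ → ℝ → ℝ) :
    tripleSum C (fun u v t => G t v u) = tripleSum C G := by
  unfold tripleSum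
  -- rename (x,y,z) ↦ (z,y,x): swap12, swap23, swap12
  rw [sum3_swap12, sum3_swap23, sum3_swap12]
  refine Finset.sum_congr rfl fun x _ => Finset.sum_congr rfl fun y _ =>
    Finset.sum_congr rfl fun z _ => ?_
  rw [real_inner_comm x y, real_inner_comm x z, real_inner_comm y z]

/-- Invariance of the triple sum under the cyclic permutations. [folklore] -/
theorem tripleSum_cyc (C : Finset E⁴) (G : ℝ → ℝ → ℝ → ℝ) :
    tripleSum C (fun u v t => G v t u) = tripleSum C G ∧
      tripleSum C (fun u v t => G t u v) = tripleSum C G := by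
  constructor
  · unfold tripleSum
    rw [sum3_swap23, sum3_swap12]
    refine Finset.sum_congr rfl fun x _ => Finset.sum_congr rfl fun y _ =>
      Finset.sum_congr rfl fun z _ => ?_
    rw [real_inner_comm x y, real_inner_comm x z]
  · unfold tripleSum
    rw [sum3_swap12, sum3_swap23]
    refine Finset.sum_congr rfl fun x _ => Finset.sum_congr rfl fun y _ =>
      Finset.sum_congr rfl fun z _ => ?_
    rw [real_inner_comm x z, real_inner_comm y z]

/-- Symmetrisation of a three-variable function over the six permutations. [folklore] -/
def sym6 (G : ℝ → ℝ → ℝ → ℝ) (u v t : ℝ) : ℝ :=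
  G u v t + G v u t + G u t v + G t v u + G v t u + G t u v

/-- `sym6 G` is symmetric in its first two arguments. [folklore] -/
theorem sym6_swap12 (G : ℝ → ℝ → ℝ → ℝ) (u v t : ℝ) : sym6 G u v t = sym6 G v u t := by
  simp only [sym6]; ring

/-- `sym6 G` is symmetric in its last two arguments. [folklore] -/
theorem sym6_swap23 (G : ℝ → ℝ → ℝ → ℝ) (u v t : ℝ) : sym6 G u v t = sym6 G u t v := by
  simp only [sym6]; ring

/-- The triple sum of the symmetrisation is six times the triple sum. [folklore] -/
theorem tripleSum_sym6 (C : Finset E⁴) (G : ℝ → ℝ → ℝ → ℝ) :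
    tripleSum C (sym6 G) = 6 * tripleSum C G := by
  have h12 := tripleSum_perm12 C G
  have h23 := tripleSum_perm23 C G
  have h13 := tripleSum_perm13 C G
  obtain ⟨hc1, hc2⟩ := tripleSum_cyc C G
  have hsplit : tripleSum C (sym6 G) = tripleSum C G + tripleSum C (fun u v t => G v u t) +
      tripleSum C (fun u v t => G u t v) + tripleSum C (fun u v t => G t v u) +
      tripleSum C (fun u v t => G v t u) + tripleSum C (fun u v t => G t u v) := by
    simp only [tripleSum, sym6, Finset.sum_add_distrib]
  rw [hsplit, h12, h23, h13, hc1, hc2]; ring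

/-! ### The Gram constraint for three unit vectors -/

/-- For unit vectors `x, y, z`: `1 + 2(x·y)(x·z)(y·z) - (x·y)² - (x·z)² - (y·z)² ≥ 0`
(nonnegativity of the Gram determinant). [cite: BachocVallentin2007, §4 (4)] -/
theorem gram3_nonneg (x y z : E⁴) (hx : ‖x‖ = 1) (hy : ‖y‖ = 1) (hz : ‖z‖ = 1) :
    0 ≤ 1 + 2 * inner ℝ x y * inner ℝ x z * inner ℝ y z - inner ℝ x y ^ 2 - inner ℝ x z ^ 2
      - inner ℝ y z ^ 2 := by
  classical
  have h := (Matrix.posSemidef_gram ℝ ![x, y, z]).det_nonneg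
  rw [Matrix.det_fin_three] at h
  have hxx : inner ℝ x x = (1 : ℝ) := by rw [real_inner_self_eq_norm_sq, hx]; norm_num
  have hyy : inner ℝ y y = (1 : ℝ) := by rw [real_inner_self_eq_norm_sq, hy]; norm_num
  have hzz : inner ℝ z z = (1 : ℝ) := by rw [real_inner_self_eq_norm_sq, hz]; norm_num
  simp only [Matrix.gram_apply, Matrix.cons_val_zero, Matrix.cons_val_one, Matrix.head_cons,
    Matrix.cons_val_two, Matrix.tail_cons, hxx, hyy, hzz] at h
  rw [real_inner_comm x y, real_inner_comm x z, real_inner_comm y z] at h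
  nlinarith [h]

/-! ### The three-point inequality -/

/-- **Bachoc–Vallentin, Theorem 4.2 (the bound from a feasible certificate)**, abstract form on
`S³`: see the module docstring. [cite: BachocVallentin2007, Theorem 4.2] -/
theorem card_le_of_threePoint (C : Finset E⁴) (hC : ∀ x ∈ C, ‖x‖ = 1)
    (hcode : ∀ x ∈ C, ∀ y ∈ C, x ≠ y → inner ℝ x y ≤ 1 / 2)
    (A : ℝ → ℝ) (F : ℝ → ℝ → ℝ → ℝ) (b11 b12 b22 : ℝ)
    (hA : 0 ≤ pairSum C A) (hF : 0 ≤ tripleSum C F)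
    (hF12 : ∀ u v t, F u v t = F v u t) (hF23 : ∀ u v t, F u v t = F u t v)
    (hb : ∀ l : ℝ, 0 ≤ b11 + 2 * b12 * l + b22 * l ^ 2)
    (h1 : ∀ s : ℝ, -1 ≤ s → s ≤ 1 / 2 → A s + 3 * F s s 1 ≤ -1 - 2 * b12 - b22)
    (h2 : ∀ u v t : ℝ, -1 ≤ u → u ≤ 1 / 2 → -1 ≤ v → v ≤ 1 / 2 → -1 ≤ t → t ≤ 1 / 2 →
      0 ≤ 1 + 2 * u * v * t - u ^ 2 - v ^ 2 - t ^ 2 → F u v t ≤ -b22)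
    (hpos : 0 ≤ 1 + A 1 + b11 + F 1 1 1) :
    (C.card : ℝ) ≤ 1 + A 1 + b11 + F 1 1 1 := by
  classical
  -- notation
  set M : ℝ := (C.card : ℝ) with hM
  by_cases hCe : C = ∅
  · simp [hM, hCe]; linarith
  obtain ⟨x0, hx0⟩ := Finset.nonempty_iff_ne_empty.2 hCe
  have hMpos : (1 : ℝ) ≤ M := by
    rw [hM]; exact_mod_cast Finset.card_pos.2 ⟨x0, hx0⟩
  have hself : ∀ x ∈ C, inner ℝ x x = (1 : ℝ) := fun x hx => by
    rw [real_inner_self_eq_norm_sq, hC x hx]; norm_num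
  -- range of inner products of distinct code points
  have hrange : ∀ x ∈ C, ∀ y ∈ C, x ≠ y → -1 ≤ inner ℝ x y ∧ inner ℝ x y ≤ 1 / 2 := by
    intro x hx y hy hxy
    refine ⟨?_, hcode x hx y hy hxy⟩
    have h := abs_real_inner_le_norm x y
    rw [hC x hx, hC y hy, mul_one] at h
    exact (abs_le.1 h).1
  -- cardinalities of punctured sets
  have hcard1 : ∀ x ∈ C, ((C.erase x).card : ℝ) = M - 1 := by
    intro x hx
    rw [Finset.card_erase_of_mem hx, Nat.cast_sub (Finset.card_pos.2 ⟨x, hx⟩), hM]; simp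
  have hcard2 : ∀ x ∈ C, ∀ y ∈ C.erase x, (((C.erase x).erase y).card : ℝ) = M - 2 := by
    intro x hx y hy
    have h2 : 2 ≤ C.card := by
      have : (C.erase x).card = C.card - 1 := Finset.card_erase_of_mem hx
      have hp : 0 < (C.erase x).card := Finset.card_pos.2 ⟨y, hy⟩
      omega
    rw [Finset.card_erase_of_mem hy, Finset.card_erase_of_mem hx, Nat.sub_sub,
      Nat.cast_sub h2, hM]
    norm_num
  -- Step a: split the pair sum
  have hpair : pairSum C A = M * A 1 + ∑ x ∈ C, ∑ y ∈ C.erase x, A (inner ℝ x y) := by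
    unfold pairSum
    rw [show M * A 1 = ∑ x ∈ C, A 1 by rw [Finset.sum_const, nsmul_eq_mul, hM],
      ← Finset.sum_add_distrib]
    refine Finset.sum_congr rfl fun x hx => ?_
    rw [← Finset.add_sum_erase C _ hx, hself x hx]
  -- Step a': split the triple sum
  have htriple : tripleSum C F = M * F 1 1 1
      + 3 * ∑ x ∈ C, ∑ y ∈ C.erase x, F (inner ℝ x y) (inner ℝ x y) 1
      + ∑ x ∈ C, ∑ y ∈ C.erase x, ∑ z ∈ (C.erase x).erase y,
          F (inner ℝ x y) (inner ℝ x z) (inner ℝ y z) := by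
    unfold tripleSum
    have hx_split : ∀ x ∈ C,
        (∑ y ∈ C, ∑ z ∈ C, F (inner ℝ x y) (inner ℝ x z) (inner ℝ y z)) =
          F 1 1 1 + 3 * ∑ y ∈ C.erase x, F (inner ℝ x y) (inner ℝ x y) 1 +
            ∑ y ∈ C.erase x, ∑ z ∈ (C.erase x).erase y,
              F (inner ℝ x y) (inner ℝ x z) (inner ℝ y z) := by
      intro x hx
      rw [← Finset.add_sum_erase C _ hx]
      -- y = x term
      have hyx : (∑ z ∈ C, F (inner ℝ x x) (inner ℝ x z) (inner ℝ x z)) =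
          F 1 1 1 + ∑ z ∈ C.erase x, F (inner ℝ x z) (inner ℝ x z) 1 := by
        rw [← Finset.add_sum_erase C _ hx, hself x hx]
        congr 1
        refine Finset.sum_congr rfl fun z _ => ?_
        rw [hF12, hF23]
      -- y ≠ x terms
      have hyne : ∀ y ∈ C.erase x,
          (∑ z ∈ C, F (inner ℝ x y) (inner ℝ x z) (inner ℝ y z)) =
            2 * F (inner ℝ x y) (inner ℝ x y) 1 +
              ∑ z ∈ (C.erase x).erase y, F (inner ℝ x y) (inner ℝ x z) (inner ℝ y z) := by
        intro y hy
        have hyC : y ∈ C := Finset.mem_of_mem_erase hy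
        rw [← Finset.add_sum_erase C _ hx, ← Finset.add_sum_erase (C.erase x) _ hy, hself x hx,
          hself y hyC, real_inner_comm x y]
        have e1 : F (inner ℝ x y) 1 (inner ℝ x y) = F (inner ℝ x y) (inner ℝ x y) 1 := by
          rw [hF23]
        rw [e1]; ring
      rw [hyx, Finset.sum_congr rfl hyne, Finset.sum_add_distrib, ← Finset.mul_sum]
      ring
    rw [Finset.sum_congr rfl hx_split, Finset.sum_add_distrib, Finset.sum_add_distrib,
      Finset.sum_const, nsmul_eq_mul, ← hM, ← Finset.mul_sum]
  -- Step b: bound the pair terms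
  have hb2 : (∑ x ∈ C, ∑ y ∈ C.erase x, (A (inner ℝ x y) + 3 * F (inner ℝ x y) (inner ℝ x y) 1))
      ≤ M * (M - 1) * (-1 - 2 * b12 - b22) := by
    have : ∀ x ∈ C, (∑ y ∈ C.erase x, (A (inner ℝ x y) + 3 * F (inner ℝ x y) (inner ℝ x y) 1))
        ≤ (M - 1) * (-1 - 2 * b12 - b22) := by
      intro x hx
      rw [← hcard1 x hx]
      have h := Finset.sum_le_card_nsmul (C.erase x)
        (fun y => A (inner ℝ x y) + 3 * F (inner ℝ x y) (inner ℝ x y) 1) (-1 - 2 * b12 - b22)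
        (fun y hy => by
          have hyC : y ∈ C := Finset.mem_of_mem_erase hy
          have hxy : x ≠ y := fun h => (Finset.ne_of_mem_erase hy) h.symm
          obtain ⟨lo, hi⟩ := hrange x hx y hyC hxy
          exact h1 _ lo hi)
      rwa [nsmul_eq_mul] at h
    calc (∑ x ∈ C, ∑ y ∈ C.erase x, (A (inner ℝ x y) + 3 * F (inner ℝ x y) (inner ℝ x y) 1))
        ≤ ∑ x ∈ C, (M - 1) * (-1 - 2 * b12 - b22) := Finset.sum_le_sum this
      _ = M * (M - 1) * (-1 - 2 * b12 - b22) := by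
        rw [Finset.sum_const, nsmul_eq_mul, ← hM]; ring
  -- Step c: bound the distinct-triple terms
  have hc3 : (∑ x ∈ C, ∑ y ∈ C.erase x, ∑ z ∈ (C.erase x).erase y,
      F (inner ℝ x y) (inner ℝ x z) (inner ℝ y z)) ≤ M * (M - 1) * (M - 2) * (-b22) := by
    have hin : ∀ x ∈ C, ∀ y ∈ C.erase x,
        (∑ z ∈ (C.erase x).erase y, F (inner ℝ x y) (inner ℝ x z) (inner ℝ y z))
          ≤ (M - 2) * (-b22) := by
      intro x hx y hy
      rw [← hcard2 x hx y hy]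
      have hyC : y ∈ C := Finset.mem_of_mem_erase hy
      have hxy : x ≠ y := fun h => (Finset.ne_of_mem_erase hy) h.symm
      have h := Finset.sum_le_card_nsmul ((C.erase x).erase y)
        (fun z => F (inner ℝ x y) (inner ℝ x z) (inner ℝ y z)) (-b22)
        (fun z hz => by
          have hz1 : z ∈ C.erase x := Finset.mem_of_mem_erase hz
          have hzC : z ∈ C := Finset.mem_of_mem_erase hz1
          have hzy : z ≠ y := Finset.ne_of_mem_erase hz
          have hzx : z ≠ x := Finset.ne_of_mem_erase hz1
          obtain ⟨lo1, hi1⟩ := hrange x hx y hyC hxy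
          obtain ⟨lo2, hi2⟩ := hrange x hx z hzC hzx.symm
          obtain ⟨lo3, hi3⟩ := hrange y hyC z hzC hzy.symm
          exact h2 _ _ _ lo1 hi1 lo2 hi2 lo3 hi3
            (gram3_nonneg x y z (hC x hx) (hC y hyC) (hC z hzC)))
      rwa [nsmul_eq_mul] at h
    have hmid : ∀ x ∈ C, (∑ y ∈ C.erase x, ∑ z ∈ (C.erase x).erase y,
        F (inner ℝ x y) (inner ℝ x z) (inner ℝ y z)) ≤ (M - 1) * ((M - 2) * (-b22)) := by
      intro x hx
      rw [← hcard1 x hx]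
      have h := Finset.sum_le_card_nsmul (C.erase x)
        (fun y => ∑ z ∈ (C.erase x).erase y, F (inner ℝ x y) (inner ℝ x z) (inner ℝ y z))
        ((M - 2) * (-b22)) (fun y hy => hin x hx y hy)
      rwa [nsmul_eq_mul] at h
    calc (∑ x ∈ C, ∑ y ∈ C.erase x, ∑ z ∈ (C.erase x).erase y,
          F (inner ℝ x y) (inner ℝ x z) (inner ℝ y z))
        ≤ ∑ x ∈ C, (M - 1) * ((M - 2) * (-b22)) := Finset.sum_le_sum hmid
      _ = M * (M - 1) * (M - 2) * (-b22) := by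
        rw [Finset.sum_const, nsmul_eq_mul, ← hM]; ring
  -- Step d: combine
  have hsum : 0 ≤ M * (A 1 + F 1 1 1) + M * (M - 1) * (-1 - 2 * b12 - b22)
      + M * (M - 1) * (M - 2) * (-b22) := by
    have htot : pairSum C A + tripleSum C F = M * (A 1 + F 1 1 1)
        + (∑ x ∈ C, ∑ y ∈ C.erase x, (A (inner ℝ x y) + 3 * F (inner ℝ x y) (inner ℝ x y) 1))
        + ∑ x ∈ C, ∑ y ∈ C.erase x, ∑ z ∈ (C.erase x).erase y,
            F (inner ℝ x y) (inner ℝ x z) (inner ℝ y z) := by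
      rw [hpair, htriple]
      simp only [Finset.sum_add_distrib, Finset.mul_sum]
      ring
    nlinarith [hA, hF, hb2, hc3, htot]
  have hquad := hb (M - 1)
  -- divide by M ≥ 1
  have hM0 : 0 < M := by linarith
  have key : 0 ≤ (A 1 + F 1 1 1) + (M - 1) * (-1 - 2 * b12 - b22) + (M - 1) * (M - 2) * (-b22) := by
    have := div_nonneg hsum hM0.le
    have e : (M * (A 1 + F 1 1 1) + M * (M - 1) * (-1 - 2 * b12 - b22)
        + M * (M - 1) * (M - 2) * (-b22)) / M
        = (A 1 + F 1 1 1) + (M - 1) * (-1 - 2 * b12 - b22) + (M - 1) * (M - 2) * (-b22) := by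
      field_simp
    linarith [this, e.symm.le, e.le]
  nlinarith [key, hquad]

end Literature.Geometry.DiscreteGeometry

end
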